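import Summits.AnomalousDissipation.AnomalousDissipation.Theorems.SawtoothPulseCascadeK1LocalisedCascadeHalfStepHO
import Summits.AnomalousDissipation.AnomalousDissipation.Theorems.SawtoothPulseCascadeK1LocalisedCascadeChirpCutoffOsc
import Summits.AnomalousDissipation.AnomalousDissipation.Theorems.SawtoothPulseCascadeK1LocalisedCascadeWindowBlockH

/-!
# K1loc, line `Spectral` / thin start — helper: THE H HALF-STEP ON A FIBRE BLOCK, OSCILLATORY CORNER SCALE (S-D, «WindowBlockHO»)

Helper file of the prover lane on the crux `K1LocalisedCascade` (stmt-AnomalousDissipation-19491), route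
`SawtoothPulseCascade` (S-D fibre ledger; memo v14 §3(c)).  The twin of `…WindowBlockVO.sum_windowBlock_vstep_osc_le` for the
H half-step `b = a ∘ Φ_H` (fibres `k₀`, window variable `k₁`, cut-off trapezoid `(Q₁,Q₂)` in `k₁`, per-fibre maximal-ramp trapezoids
`(p(k₀), |k₀|γ)`) over `…HalfStepHO`: **`sum_windowBlock_hstep_osc_le`** —
`Σ_{k∈W}‖𝓕(a∘Φ_H)(k)‖² ≤ (((Q₁+Q₂)/(Q₂−Q₁))·(ε₀ + A√(2N_j·4d₀)) + √(Σ' k, [Λ ≤ |k₀| ≤ Λ' ∧ Q₁ < |k₁|]‖𝓕a(k)‖²))²`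
for `W` finite with `|k₁| + Q₂ ≤ p(k₀) < |k₀|γ`, `Λ ≤ |k₀| ≤ Λ'`, `(p+|k₀|γ)/(|k₀|γ−p) ≤ A`, `Dm ≤ |k₀|γ − p` on `W`,
`1/(2πDm) + 4Mδ_j/(πDm·d₀) ≤ A·d₀`, `Mδ_j < πN_j d₀`, `ε₀ ≥ A·πΛ'γe^{−M²/2}/N_j + 2N_j/(πDm)`.
Same proof with the coordinates exchanged.  No definitions; no statement about the crux.
[cite: Grafakos2014, Prop. 3.1.2 (5), Prop. 3.2.7 (3), §3.1.3] [cite: ElgindiLissMattingly2025, §1 (slope ±1 branches)] [problem: turb]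
-/

-- `Summit.<Summit>.<Problem>`: single-conjunct summit, the duplicate namespace segment is deliberate.
set_option linter.dupNamespace false

noncomputable section

namespace Summit.AnomalousDissipation.AnomalousDissipation.Theorems.SawtoothPulseCascade.K1Window

open MeasureTheory Set Filter Topology UnitAddTorus Function Complex Metric
open scoped Real ENNReal
open Literature.Analysis Literature.Analysis.FunctionSpaces Literature.Analysis.FunctionSpaces.Torus Literature.Analysis.FluidPDE
open Literature.Analysis.FluidPDE.ShearStage
open Literature.Analysis.FluidPDE.SawtoothCascade Literature.Analysis.FluidPDE.SawtoothCascade.CascadeParams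
open Summit.AnomalousDissipation.AnomalousDissipation.Theorems.SawtoothPulseCascade.K1Start
open Summit.AnomalousDissipation.AnomalousDissipation.Theorems.SawtoothPulseCascade.K1Flat

/-! ## The H half-step on a fibre block for a general window, oscillatory corner scale -/

/-- **THE H HALF-STEP ON A FIBRE BLOCK, GENERAL WINDOW, OSCILLATORY CORNER SCALE** (see the file header): `χ` the `(Q₁, Q₂)`
trapezoid in `k₁`, `ψ_n` the `(p(n), |n|γ)` trapezoids, `A` a uniform bound of their `L¹` norms and `Dm > 0` a uniform lower bound of
their ramp widths on the fibres of `W`. [cite: Grafakos2014, Prop. 3.1.2 (5), Prop. 3.2.7 (3), §3.1.3] -/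
theorem sum_windowBlock_hstep_osc_le (P : CascadeParams) {G : ℕ} (hγ : P.γ = G) (hδ₀ : 0 < P.δ₀) (hd : 0 < P.d)
    (hN₀ : 1 ≤ P.N₀) (hρN : 1 ≤ P.ρN) (j : ℕ)
    {b : UnitAddTorus (Fin 2) → ℂ} (hb : Continuous b) (hbs : Summable fun k => ‖mFourierCoeff b k‖) (hb1 : ∀ x, ‖b x‖ ≤ 1)
    {Q₁ Q₂ Λ Λ' : ℕ} (hQ : Q₁ < Q₂) (p : ℤ → ℕ)
    (W : Finset (Fin 2 → ℤ)) (hW : ∀ k ∈ W, (Λ : ℤ) ≤ |k 0| ∧ |k 0| ≤ Λ')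
    (hWp : ∀ k ∈ W, |k 1| + Q₂ ≤ (p (k 0) : ℤ)) (hpG : ∀ k ∈ W, p (k 0) < (k 0).natAbs * G)
    {d₀ M ε₀ A Dm : ℝ} (hd₀ : 0 < d₀) (hM : 1 ≤ M) (hMδ : M * P.δ j < π / 2) (hMd : M * P.δ j < π * P.N j * d₀)
    (hA0 : 0 ≤ A) (hA : ∀ k ∈ W, ((p (k 0) : ℝ) + ((k 0).natAbs * G : ℕ)) / ((((k 0).natAbs * G : ℕ) : ℝ) - p (k 0)) ≤ A)
    (hDm : 0 < Dm) (hD : ∀ k ∈ W, Dm ≤ (((k 0).natAbs * G : ℕ) : ℝ) - p (k 0))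
    (hAd : 1 / (2 * π * Dm) + 4 * M * P.δ j / (π * Dm * d₀) ≤ A * d₀) (hε0 : 0 ≤ ε₀)
    (hε : A * (2 * π * ((Λ' * G : ℕ) : ℝ) * (Real.exp (-(M ^ 2 / 2)) / (2 * P.N j))) + 2 * P.N j / (π * Dm) ≤ ε₀) :
    ∑ k ∈ W, ‖mFourierCoeff (b ∘ shearMap 0 1 (amp ⟨P.U j, P.U_periodic j, P.contDiff_U (P.δ_pos hδ₀ hd j)⟩ P.γ)) k‖ ^ 2 ≤
      ((((Q₁ : ℝ) + Q₂) / ((Q₂ : ℝ) - Q₁)) * (ε₀ + A * Real.sqrt ((2 * P.N j : ℕ) * (4 * d₀))) +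
        Real.sqrt (∑' k : Fin 2 → ℤ, (if (Λ : ℤ) ≤ |k 0| ∧ |k 0| ≤ Λ' ∧ (Q₁ : ℤ) < |k 1| then (1 : ℝ) else 0) *
          ‖mFourierCoeff b k‖ ^ 2)) ^ 2 := by
  classical
  -- the data of `…HalfStepHO`
  set χ : ℤ → ℂ := fun m => ((min 1 (max 0 (((Q₂ : ℝ) - |(m : ℝ)|) / ((Q₂ : ℝ) - Q₁))) : ℝ) : ℂ) with hχdef
  have hχ : ∀ m : ℤ, χ m = ((min 1 (max 0 (((Q₂ : ℝ) - |(m : ℝ)|) / ((Q₂ : ℝ) - Q₁))) : ℝ) : ℂ) := fun m => rfl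
  set ψ : ℤ → ℤ → ℂ := fun n m => if p n < n.natAbs * G then
      ((min 1 (max 0 ((((n.natAbs * G : ℕ) : ℝ) - |(m : ℝ)|) / (((n.natAbs * G : ℕ) : ℝ) - p n))) : ℝ) : ℂ) else 0 with hψdef
  set Sψ : ℤ → Finset ℤ := fun n => Finset.Icc (-((n.natAbs * G : ℕ) : ℤ)) (n.natAbs * G : ℕ) with hSψ
  -- fibres of the window and the trapezoid facts on them
  have hnat : ∀ k ∈ W, Λ ≤ (k 0).natAbs ∧ (k 0).natAbs ≤ Λ' := fun k hk => by
    obtain ⟨h2, h3⟩ := hW k hk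
    rw [← Int.natCast_natAbs] at h2 h3
    exact ⟨by exact_mod_cast h2, by exact_mod_cast h3⟩
  have hfib : ∀ k ∈ W, p (k 0) < (k 0).natAbs * G := hpG
  have hψk : ∀ k ∈ W, ∀ m : ℤ, ψ (k 0) m =
      ((min 1 (max 0 (((((k 0).natAbs * G : ℕ) : ℝ) - |(m : ℝ)|) / ((((k 0).natAbs * G : ℕ) : ℝ) - p (k 0)))) : ℝ) : ℂ) :=
    fun k hk m => by simp only [hψdef, if_pos (hfib k hk)]
  have hnG : ∀ n : ℤ, ((n.natAbs * G : ℕ) : ℤ) = |n * G| := fun n => by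
    rw [abs_mul, Nat.cast_mul, Int.natCast_natAbs, abs_of_nonneg (Int.natCast_nonneg G)]
  -- the hypotheses of the abstract half-step
  have hχS : ∀ l, l ∉ Finset.Icc (-(Q₂ : ℤ)) Q₂ → χ l = 0 := trapezoid_support hQ hχ
  have hχ1 : ∀ l, ‖χ l‖ ≤ 1 := fun l => (trapezoid_values hQ hχ l).2.2
  have hχL : ∀ l, χ l ≠ 0 → |l| < (Q₂ : ℤ) := fun l hl => by
    by_contra h; push Not at h; exact hl ((trapezoid_values hQ hχ l).2.1 h)
  have hψS : ∀ n m, m ∉ Sψ n → ψ n m = 0 := by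
    intro n m hm
    by_cases hn : p n < n.natAbs * G
    · have := trapezoid_support hn (χ := ψ n) (fun m' => by simp only [hψdef, if_pos hn]) m hm
      exact this
    · simp only [hψdef, if_neg hn]
  have hψ1 : ∀ k ∈ W, ∀ l : ℤ, |l| < (Q₂ : ℤ) → ψ (k 0) (k 1 - l) = 1 := by
    intro k hk l hl
    refine (trapezoid_values (hfib k hk) (hψk k hk) _).1 ?_
    have h0 := hWp k hk
    have : |k 1 - l| ≤ |k 1| + |l| := abs_sub _ _
    linarith
  have hA' : ∀ k ∈ W, (∫ s : UnitAddCircle, ‖∑ m ∈ Sψ (k 0), ψ (k 0) m * fourier (-m) s‖) ≤ A := fun k hk =>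
    (integral_norm_trapezoidKernel_le_ratio (hfib k hk) (hψk k hk)).trans (hA k hk)
  -- the oscillatory socket and the pointwise kernel socket, from the minimal ramp width `Dm`
  have hNpos : 0 < P.N j := N_pos P hN₀ hρN j
  have hNr : (0 : ℝ) < P.N j := by exact_mod_cast hNpos
  have hDk : ∀ k ∈ W, 0 < (((k 0).natAbs * G : ℕ) : ℝ) - p (k 0) := fun k hk => hDm.trans_le (hD k hk)
  have hL₂ : ∀ k : Fin 2 → ℤ, (k 0 * G).natAbs = (k 0).natAbs * G := fun k => by
    rw [Int.natAbs_mul, Int.natAbs_natCast]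
  have hosc' : ∀ k ∈ W, ∀ t r : ℝ, 0 < r → (∀ m : ℤ, 2 * π * P.N j * r ≤ |2 * π * P.N j * t - (π / 2 + π * m)|) →
      ‖∫ s : UnitAddCircle, (∑ m ∈ Sψ (k 0), ψ (k 0) m * fourier (-m) s) *
        (periodic_exactChirpFun (P.N j) (k 0 * G)).lift ((t : UnitAddCircle) + s)‖ ≤ 1 / (2 * π * Dm) / r + 2 * P.N j / (π * Dm) := by
    intro k hk t r hr hfar
    obtain ⟨hg0c, hg0t⟩ := continuous_exactChirp_lift (P.N j) (k 0 * G)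
    have h := norm_circleCutoff_exactChirp_osc_le_of_far hNpos (hL₂ k) (hfib k hk) hg0c hg0t (hψk k hk) hr hfar
    refine h.trans (add_le_add ?_ ?_)
    · rw [div_div]
      have h2r : 0 < 2 * π * r := by positivity
      exact one_div_le_one_div_of_le (by positivity)
        (by nlinarith [mul_nonneg (sub_nonneg.mpr (hD k hk)) h2r.le])
    · exact div_le_div_of_nonneg_left (by positivity) (by positivity) (mul_le_mul_of_nonneg_left (hD k hk) Real.pi_pos.le)
  have hκ' : ∀ k ∈ W, ∀ s : UnitAddCircle, s ≠ 0 → ‖∑ m ∈ Sψ (k 0), ψ (k 0) m * fourier (-m) s‖ ≤ 1 / (4 * Dm) / ‖s‖ ^ 2 := by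
    intro k hk s hs
    have hs' : 0 < ‖s‖ := norm_pos_iff.mpr hs
    refine (norm_trapezoidKernel_le_inv_four_mul_sq (hfib k hk) (hψk k hk) hs').trans ?_
    rw [div_div]
    have hs2 : 0 < ‖s‖ ^ 2 := pow_pos hs' 2
    have hden : 0 < 4 * Dm * ‖s‖ ^ 2 := by positivity
    exact one_div_le_one_div_of_le hden (by nlinarith [mul_nonneg (sub_nonneg.mpr (hD k hk)) hs2.le])
  have hAd' : 1 / (2 * π * Dm) + 16 * (1 / (4 * Dm)) * M * P.δ j / (π * d₀) ≤ A * d₀ := by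
    have e : 16 * (1 / (4 * Dm)) * M * P.δ j / (π * d₀) = 4 * M * P.δ j / (π * Dm * d₀) := by
      field_simp; ring
    rw [e]; exact hAd
  have hε' : ∀ k ∈ W, A * (2 * π * |((k 0 * G : ℤ) : ℝ)| * (Real.exp (-(M ^ 2 / 2)) / (2 * P.N j))) + 2 * P.N j / (π * Dm) ≤ ε₀ := by
    intro k hk
    have hmono : A * (2 * π * |((k 0 * G : ℤ) : ℝ)| * (Real.exp (-(M ^ 2 / 2)) / (2 * P.N j))) ≤
        A * (2 * π * ((Λ' * G : ℕ) : ℝ) * (Real.exp (-(M ^ 2 / 2)) / (2 * P.N j))) := by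
      refine mul_le_mul_of_nonneg_left (mul_le_mul_of_nonneg_right
        (mul_le_mul_of_nonneg_left ?_ (by positivity)) (by positivity)) hA0
      rw [← Int.cast_abs, ← hnG]
      exact_mod_cast Nat.mul_le_mul_right _ (hnat k hk).2
    linarith [hmono, hε]
  -- the abstract half-step
  have hmain := sum_window_sq_norm_hstep_osc_le P hγ hδ₀ hd hN₀ hρN j hb hbs hb1 W χ _ hχS hχ1 Q₂ hχL ψ Sψ hψS hψ1
    hd₀ hM hMδ hMd hA0 hA' hosc' (by positivity : (0 : ℝ) ≤ 1 / (4 * Dm)) hκ' hAd' hε0 hε'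
  refine hmain.trans (pow_le_pow_left₀ (by positivity) (add_le_add ?_ (Real.sqrt_le_sqrt ?_)) 2)
  · -- kernel `L¹` norm of the input trapezoid
    have hK := integral_norm_trapezoidKernel_le_ratio hQ hχ
    have hS0 : 0 ≤ ε₀ + A * Real.sqrt ((2 * P.N j : ℕ) * (4 * d₀)) := by positivity
    exact mul_le_mul_of_nonneg_right hK hS0
  · -- the pass-through term as a spectral class
    refine sum_passThrough_le_tsum_h hb hχS (fun l => ?_) (fun l hl => (trapezoid_values hQ hχ l).1 hl) _
      (fun n hn => ?_)
    · exact ⟨_, (clamp_facts (((Q₂ : ℝ) - |(l : ℝ)|) / ((Q₂ : ℝ) - Q₁)) 0).1,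
        (clamp_facts (((Q₂ : ℝ) - |(l : ℝ)|) / ((Q₂ : ℝ) - Q₁)) 0).2.1, hχ l⟩
    · obtain ⟨k, hk, rfl⟩ := Finset.mem_image.mp hn
      exact hW k hk

end Summit.AnomalousDissipation.AnomalousDissipation.Theorems.SawtoothPulseCascade.K1Window
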